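import Mathlib
import Summits.AtomisticToContinuum.FouriersLaw.Theses.GriffithsLimitExchange

/-!
# The sandwich glue of route `GriffithsLimitExchange` (`SandwichGlue`), proved

Closes item `stmt-AtomisticToContinuum-13204` — the decl `SandwichGlue` of the route file
`Summits/AtomisticToContinuum/FouriersLaw/Theses/GriffithsLimitExchange`:

  `BoundaryDEP → KernelIntegrable → FiniteHorizonTransmission → PositiveTransmission →
   VanishingSurvival → TransmissionLaw`.

This is pure real analysis (no property of the chain is used):

* `kernel_sandwich` — for kernels `K, Kt` nonnegative on `[0,∞)` and integrable on `(0,∞)` and a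
  horizon `t ≥ 0`, splitting `(0,∞) = (0,t] ∪ (t,∞)` and dropping / adding nonnegative tails gives
  `∫_{(0,t]} Kt ≤ ∫_{(0,∞)} Kt ≤ ∫_{(0,t]} Kt + ∫_{(t,∞)} (K + Kt)`,
  i.e. `X_N(t) ≤ E_N ≤ X_N(t) + S_N(t)` after multiplying by `γ/T² ≥ 0`.
* `squeeze_abstract` — if `X N t ≤ E N ≤ X N t + S N t` for all `t ≥ 0`, the finite-horizon limits
  `N·X_N(A N²) → x(A)` exist (FH), `N·S_N(A N²) ≤ ε` eventually for a suitable `A = A(ε)` (VS) and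
  `N·X_N(A₀N²) ≥ c > 0` eventually (PT), then `N·E_N` is a Cauchy sequence, its limit `e` is `≥ c`,
  `E_N = (N·E_N)/N → 0`, and `(N-1)·γ·E_N = γ·(N·E_N) - γ·E_N → γ·e =: κ_b > 0`.
* `glue_abstract` — the two combined, in the literal shape of the route's hypotheses with the
  kernels abstracted to `K Kt : ℕ → ℝ → ℝ` and the prefactor to `c ≥ 0`.
* `sandwichGlue_proof : SandwichGlue` — specialisation to the route's kernels (`c = γ/T²`).
-/

namespace Summit.AtomisticToContinuum.FouriersLaw.Theorems.SandwichGlue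

open Filter Set MeasureTheory Topology

/-- **Kernel sandwich.** For kernels `K, Kt : ℝ → ℝ` that are nonnegative on `[0,∞)` and
integrable on `(0,∞)`, and a horizon `0 ≤ t`, the total mass of `Kt` on `(0,∞)` lies between its
mass on `(0,t]` and that mass plus the tail mass of `K + Kt` on `(t,∞)`. -/
theorem kernel_sandwich {K Kt : ℝ → ℝ}
    (hK : ∀ u, 0 ≤ u → 0 ≤ K u) (hKt : ∀ u, 0 ≤ u → 0 ≤ Kt u)
    (hKi : IntegrableOn K (Ioi 0)) (hKti : IntegrableOn Kt (Ioi 0))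
    {t : ℝ} (ht : 0 ≤ t) :
    (∫ u in Ioc 0 t, Kt u) ≤ (∫ u in Ioi 0, Kt u) ∧
      (∫ u in Ioi 0, Kt u) ≤ (∫ u in Ioc 0 t, Kt u) + ∫ u in Ioi t, (K u + Kt u) := by
  have hsub : Ioi t ⊆ Ioi (0 : ℝ) := Ioi_subset_Ioi ht
  have hsplit : (∫ u in Ioi 0, Kt u) = (∫ u in Ioc 0 t, Kt u) + ∫ u in Ioi t, Kt u := by
    rw [← Ioc_union_Ioi_eq_Ioi ht]
    exact setIntegral_union (Ioc_disjoint_Ioi le_rfl) measurableSet_Ioi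
      (hKti.mono_set Ioc_subset_Ioi_self) (hKti.mono_set hsub)
  have htail_nonneg : 0 ≤ ∫ u in Ioi t, Kt u :=
    setIntegral_nonneg measurableSet_Ioi fun u hu => hKt u (ht.trans (le_of_lt hu))
  have htail_le : (∫ u in Ioi t, Kt u) ≤ ∫ u in Ioi t, (K u + Kt u) := by
    refine setIntegral_mono_on (hKti.mono_set hsub)
      ((hKi.mono_set hsub).add (hKti.mono_set hsub)) measurableSet_Ioi ?_
    intro u hu
    have hKu : 0 ≤ K u := hK u (ht.trans (le_of_lt hu))
    linarith
  refine ⟨?_, ?_⟩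
  · rw [hsplit]
    linarith
  · rw [hsplit]
    linarith

/-- **Abstract squeeze.** If `X N t ≤ E N ≤ X N t + S N t` for every `N` and every `t ≥ 0`, the
finite-horizon rescaled transmissions `N·X N (A·N²)` converge for every `A > 0` (FH), the rescaled
survival `N·S N (A·N²)` is eventually `≤ ε` for a suitable horizon `A = A(ε)` (VS), and
`N·X N (A₀·N²) ≥ c > 0` eventually (PT), then `(N-1)·γ·E N` converges to some `κ_b > 0`
(namely `γ·lim N·E N`). -/
theorem squeeze_abstract {γ : ℝ} (hγ : 0 < γ) {E : ℕ → ℝ} {X S : ℕ → ℝ → ℝ}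
    (hsand : ∀ (N : ℕ) (t : ℝ), 0 ≤ t → X N t ≤ E N ∧ E N ≤ X N t + S N t)
    (hFH : ∀ A : ℝ, 0 < A → ∃ x : ℝ,
      Tendsto (fun N : ℕ => (N : ℝ) * X N (A * (N : ℝ) ^ 2)) atTop (𝓝 x))
    (hPT : ∃ A c : ℝ, 0 < A ∧ 0 < c ∧
      ∀ᶠ N : ℕ in atTop, c ≤ (N : ℝ) * X N (A * (N : ℝ) ^ 2))
    (hVS : ∀ ε : ℝ, 0 < ε → ∃ A : ℝ, 0 < A ∧
      ∀ᶠ N : ℕ in atTop, (N : ℝ) * S N (A * (N : ℝ) ^ 2) ≤ ε) :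
    ∃ κb : ℝ, 0 < κb ∧ Tendsto (fun N : ℕ => ((N : ℝ) - 1) * γ * E N) atTop (𝓝 κb) := by
  -- the sandwich at the diffusive horizon `t = A·N²`, multiplied by `N ≥ 0`
  have hlow : ∀ A : ℝ, 0 < A → ∀ N : ℕ,
      (N : ℝ) * X N (A * (N : ℝ) ^ 2) ≤ (N : ℝ) * E N := by
    intro A hA N
    have hN : (0 : ℝ) ≤ N := Nat.cast_nonneg N
    have ht : 0 ≤ A * (N : ℝ) ^ 2 := by positivity
    exact mul_le_mul_of_nonneg_left (hsand N _ ht).1 hN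
  have hup : ∀ A : ℝ, 0 < A → ∀ N : ℕ,
      (N : ℝ) * E N ≤ (N : ℝ) * X N (A * (N : ℝ) ^ 2) + (N : ℝ) * S N (A * (N : ℝ) ^ 2) := by
    intro A hA N
    have hN : (0 : ℝ) ≤ N := Nat.cast_nonneg N
    have ht : 0 ≤ A * (N : ℝ) ^ 2 := by positivity
    have h := mul_le_mul_of_nonneg_left (hsand N _ ht).2 hN
    rwa [mul_add] at h
  -- `N·E N` is a Cauchy sequence
  have hcauchy : CauchySeq fun N : ℕ => (N : ℝ) * E N := by
    refine Metric.cauchySeq_iff.2 fun ε hε => ?_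
    obtain ⟨A, hA, hS⟩ := hVS (ε / 3) (by positivity)
    obtain ⟨x, hx⟩ := hFH A hA
    have hx' : ∀ᶠ N : ℕ in atTop, dist ((N : ℝ) * X N (A * (N : ℝ) ^ 2)) x < ε / 3 :=
      Metric.tendsto_nhds.1 hx (ε / 3) (by positivity)
    obtain ⟨N₀, hN₀⟩ := eventually_atTop.1 (hx'.and hS)
    refine ⟨N₀, fun m hm n hn => ?_⟩
    obtain ⟨hm1, hm2⟩ := hN₀ m hm
    obtain ⟨hn1, hn2⟩ := hN₀ n hn
    have h1 := hlow A hA m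
    have h2 := hup A hA m
    have h3 := hlow A hA n
    have h4 := hup A hA n
    rw [Real.dist_eq, abs_sub_lt_iff] at hm1 hn1 ⊢
    constructor <;> linarith [hm1.1, hm1.2, hn1.1, hn1.2]
  obtain ⟨e, he⟩ := cauchySeq_tendsto_of_complete hcauchy
  -- the limit is positive
  obtain ⟨A₀, c, hA₀, hc, hev⟩ := hPT
  have hce : c ≤ e := by
    refine ge_of_tendsto he ?_
    filter_upwards [hev] with N hN
    exact hN.trans (hlow A₀ hA₀ N)
  have he_pos : 0 < e := hc.trans_le hce
  -- `E N = (N·E N)/N → 0`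
  have hE : Tendsto E atTop (𝓝 0) := by
    have h1 : Tendsto (fun N : ℕ => (N : ℝ) * E N * ((N : ℝ))⁻¹) atTop (𝓝 (e * 0)) :=
      he.mul tendsto_inv_atTop_nhds_zero_nat
    rw [mul_zero] at h1
    refine h1.congr' ?_
    filter_upwards [eventually_gt_atTop 0] with N hN
    have hN' : (N : ℝ) ≠ 0 := Nat.cast_ne_zero.2 (Nat.pos_iff_ne_zero.1 hN)
    rw [mul_comm (N : ℝ) (E N), mul_inv_cancel_right₀ hN']
  -- conclusion: `(N-1)·γ·E N = γ·(N·E N) - γ·E N → γ·e - 0`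
  refine ⟨γ * e, mul_pos hγ he_pos, ?_⟩
  have h2 : Tendsto (fun N : ℕ => γ * ((N : ℝ) * E N) - γ * E N) atTop (𝓝 (γ * e - γ * 0)) :=
    (he.const_mul γ).sub (hE.const_mul γ)
  rw [mul_zero, sub_zero] at h2
  refine h2.congr' (Eventually.of_forall fun N => ?_)
  ring

/-- **The glue, abstract kernels.** The literal shape of the route's five hypotheses with the two
boundary kernels abstracted to `K Kt : ℕ → ℝ → ℝ` and the prefactor `γ/T²` to a constant `c ≥ 0`:
sign (DEP) + integrability + finite-horizon limits (FH) + positive transmission (PT) + vanishing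
survival (VS) give `(N-1)·γ·(c·∫_{(0,∞)} Kt N) → κ_b > 0`. -/
theorem glue_abstract {γ c : ℝ} (hγ : 0 < γ) (hc : 0 ≤ c) {K Kt : ℕ → ℝ → ℝ}
    (hDEP : ∀ (N : ℕ) (u : ℝ), 0 ≤ u → 0 ≤ K N u ∧ 0 ≤ Kt N u)
    (hKI : ∀ N : ℕ, IntegrableOn (K N) (Ioi 0) ∧ IntegrableOn (Kt N) (Ioi 0))
    (hFH : ∀ A : ℝ, 0 < A → ∃ x : ℝ, Tendsto
      (fun N : ℕ => (N : ℝ) * (c * ∫ u in Ioc 0 (A * (N : ℝ) ^ 2), Kt N u)) atTop (𝓝 x))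
    (hPT : ∃ A c' : ℝ, 0 < A ∧ 0 < c' ∧ ∀ᶠ N : ℕ in atTop,
      c' ≤ (N : ℝ) * (c * ∫ u in Ioc 0 (A * (N : ℝ) ^ 2), Kt N u))
    (hVS : ∀ ε : ℝ, 0 < ε → ∃ A : ℝ, 0 < A ∧ ∀ᶠ N : ℕ in atTop,
      (N : ℝ) * (c * ∫ u in Ioi (A * (N : ℝ) ^ 2), (K N u + Kt N u)) ≤ ε) :
    ∃ κb : ℝ, 0 < κb ∧
      Tendsto (fun N : ℕ => ((N : ℝ) - 1) * γ * (c * ∫ u in Ioi 0, Kt N u)) atTop (𝓝 κb) := by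
  have hsand : ∀ (N : ℕ) (t : ℝ), 0 ≤ t →
      (c * ∫ u in Ioc 0 t, Kt N u) ≤ (c * ∫ u in Ioi 0, Kt N u) ∧
        (c * ∫ u in Ioi 0, Kt N u) ≤ (c * ∫ u in Ioc 0 t, Kt N u) +
          c * ∫ u in Ioi t, (K N u + Kt N u) := by
    intro N t ht
    obtain ⟨h1, h2⟩ := kernel_sandwich (fun u hu => (hDEP N u hu).1) (fun u hu => (hDEP N u hu).2)
      (hKI N).1 (hKI N).2 ht
    refine ⟨mul_le_mul_of_nonneg_left h1 hc, ?_⟩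
    have h3 := mul_le_mul_of_nonneg_left h2 hc
    rwa [mul_add] at h3
  exact squeeze_abstract hγ (E := fun N => c * ∫ u in Ioi 0, Kt N u)
    (X := fun N t => c * ∫ u in Ioc 0 t, Kt N u)
    (S := fun N t => c * ∫ u in Ioi t, (K N u + Kt N u)) hsand hFH hPT hVS

end Summit.AtomisticToContinuum.FouriersLaw.Theorems.SandwichGlue

namespace Summit.AtomisticToContinuum.FouriersLaw.Theorems

open Summit.AtomisticToContinuum.FouriersLaw.Theses.GriffithsLimitExchange

/-- **SandwichGlue** (item `stmt-AtomisticToContinuum-13204` of route `GriffithsLimitExchange`):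
`BoundaryDEP → KernelIntegrable → FiniteHorizonTransmission → PositiveTransmission →
VanishingSurvival → TransmissionLaw`. With the sign of the two boundary kernels (DEP) and their
integrability, `X_N(t) ≤ E_N ≤ X_N(t) + S_N(t)` for every `t ≥ 0`; the three finite-horizon inputs
then squeeze `N·E_N → e ∈ [c, ∞)` and `(N-1)·γ·E_N → γ·e =: κ_b > 0`
(`SandwichGlue.glue_abstract` with `c = γ/T²`). -/
theorem sandwichGlue_proof :
    Summit.AtomisticToContinuum.FouriersLaw.Theses.GriffithsLimitExchange.SandwichGlue := by
  unfold Summit.AtomisticToContinuum.FouriersLaw.Theses.GriffithsLimitExchange.SandwichGlue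
  intro hDEP hKI hFH hPT hVS ω₂ lam β γ hω hl hβ hγ T hT
  have hDEP' := hDEP ω₂ lam β γ hω hl hβ hγ T hT
  have hKI' := hKI ω₂ lam β γ hω hl hβ hγ T hT
  have hFH' := hFH ω₂ lam β γ hω hl hβ hγ T hT
  have hPT' := hPT ω₂ lam β γ hω hl hβ hγ T hT
  have hVS' := hVS ω₂ lam β γ hω hl hβ hγ T hT
  dsimp only at hDEP' hKI' hFH' hPT' hVS' ⊢
  have hc : 0 ≤ γ / T ^ 2 := by positivity
  exact SandwichGlue.glue_abstract hγ hc hDEP' hKI' hFH' hPT' hVS'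

end Summit.AtomisticToContinuum.FouriersLaw.Theorems
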